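import Summits.ValiantsHypothesis.ValiantsHypothesis.Theorems.NewtonUnitEquationsTwoProductsTowerRecordCount

/-!
# R13-coeff — SPARSE LEVELS: the exchange set replaces the height; THREE-LEVEL RECORD LAW `(23,2)`, height-free

(5/6) ★ `card_cellLettersG_le` (levels in `E`, exchange set `Λ` with `2m|Λ+E| < (2m+1)|Λ|`, arrangement `J ⊇ Λ − Λ` ⇒ `≤ 2m` record carriers per
cell), ★ `towerRecordCountG` (`#records ≤ 64(n²|J|+3)(m+1)2^{3m}` for any exchange set), the three-level exchange set `gap H C = {a + bH : a,b ≤ C}`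
and its difference set `gapJ`, `arith_sparse`, ★★ `threeLevelRecordLaw_holds : ThreeLevelRecordLaw` (`(a,b) = (23,2)`, uniformly in the height `H`).
Transplant (val-lit-p3 g18) of val-idea-37 g4's kernel-checked scratch `Cruxes/TwoProducts/TowerRecords_val_idea_37_g4.lean` (rev 3,
sha16 988768bd6d8db99a, ns `ValIdea37g4T`; val-idea-crit-8 g2 VERDICT #19 + addendum: KEEP «R13-coeff», by-name GO for a verbatim transplant);
proofs verbatim by name, docstrings added, namespace = the tree's.  Helper on crux `stmt-ValiantsHypothesis-5906` (`TwoProducts`, line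
`relation_ladder`); `--supports`, closes nothing by itself.  HONEST LABEL (crit-8 #19): COEFFICIENT-SIDE; the class rung it feeds (R13, dense
parallel towers on dissociated carriers) is a wider CLASS rung, inert as a hatch; F10's collinear digit towers NOT covered; `ResidualLawV24` ⟺
`PlanarCellBound`, the crux (stmt-5906), every `closes` binder and every summit statement UNMOVED; VP ≠ VNP is NOT proved.
Credit: mathematics and kernel proofs val-idea-37 g4; critic of record val-idea-crit-8 g2.  No instances, no notation, no named facts. [folklore]
-/

set_option linter.dupNamespace false

noncomputable section

open Classical

namespace Summit.ValiantsHypothesis.ValiantsHypothesis.Theorems.NewtonUnitEquations.TwoProducts.TowerRecord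

open scoped BigOperators
open Module Polynomial
open Summit.ValiantsHypothesis.ValiantsHypothesis.Theorems.NewtonUnitEquations.TwoProducts.FormalLogLinearisation
open Summit.ValiantsHypothesis.ValiantsHypothesis.Theorems.NewtonUnitEquations.TwoProducts.MomentRecord
open Summit.ValiantsHypothesis.ValiantsHypothesis.Theorems.NewtonUnitEquations.TwoProducts.PlanarCell

variable {m n : ℕ}

section SparseFile
open Pointwise

/-- Record letters of a cell of the sparse arrangement. -/
def cellLettersG (γ γ' : Fin m → Fin n → ℂ[X]) (x : Fin n → Expo) (d : Fin 2 → ℤ) (J : Finset ℤ) (m' : ℕ)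
    (κ : (Bool × Bool × Bool × Bool) × ℕ × Bool) : Finset (Fin n) :=
  Finset.univ.filter fun a => ∃ ξ : Fin 2 → ℝ, cellZ (tfamG x d J) ξ = κ ∧
    ∃ (S : Fin n → ℕ) (k : ℕ), IsRecordT γ γ' x d m' ξ (S, k) ∧ 0 < S a

/-- **≤ 2m record carriers per cell, SPARSE form**: levels in `E`, an exchange set `Λ` with `2m|Λ+E| < (2m+1)|Λ|`, arrangement `J ⊇ Λ − Λ`. -/
theorem card_cellLettersG_le (γ γ' : Fin m → Fin n → ℂ[X]) (E Λ : Finset ℕ)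
    (hγ : ∀ j i, (γ j i).support ⊆ E) (hγ' : ∀ j i, (γ' j i).support ⊆ E)
    (hΛ : 2 * m * (Λ + E).card < (2 * m + 1) * Λ.card) (J : Finset ℤ) (hJ : ∀ u ∈ Λ, ∀ v ∈ Λ, ((u : ℤ) - v) ∈ J)
    (x : Fin n → Expo) (d : Fin 2 → ℤ) (m' : ℕ) (κ : (Bool × Bool × Bool × Bool) × ℕ × Bool) :
    (cellLettersG γ γ' x d J m' κ).card ≤ 2 * m := by
  by_contra hgt
  rw [not_le] at hgt
  obtain ⟨L', hsub, hcardL⟩ := Finset.exists_subset_card_eq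
    (show 2 * m + 1 ≤ (cellLettersG γ γ' x d J m' κ).card by omega)
  have hwit : ∀ b ∈ L', ∃ ξ : Fin 2 → ℝ, cellZ (tfamG x d J) ξ = κ ∧
      ∃ (S : Fin n → ℕ) (k : ℕ), IsRecordT γ γ' x d m' ξ (S, k) ∧ 0 < S b := by
    intro b hb
    have := hsub hb
    simpa [cellLettersG] using this
  have hsupp : ∀ (b : ↥L') (i : Fin m ⊕ Fin m), (tvec γ γ' (b : Fin n) i).support ⊆ E := by
    rintro b (j | j)
    · exact hγ j b
    · exact hγ' j b
  have hcard : Fintype.card (Fin m ⊕ Fin m) * (Λ + E).card < Fintype.card ↥L' * Λ.card := by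
    rw [Fintype.card_sum, Fintype.card_fin, Fintype.card_coe, hcardL, ← two_mul]
    exact hΛ
  obtain ⟨lam, ⟨b₀, hb₀⟩, hsuppL, hrelS⟩ :=
    siegel_dependence_supp (ι := Fin m ⊕ Fin m) (κ := ↥L') (fun b => tvec γ γ' (b : Fin n)) E Λ hsupp hcard
  obtain ⟨ξs, hξs, -⟩ := hwit b₀ b₀.2
  let ν : ↥L' → ℕ := fun b => if 0 < wtZ ξs d then (lam b).natDegree else (lam b).natTrailingDegree
  have hνΛ : ∀ b, lam b ≠ 0 → ν b ∈ Λ := fun b hb => by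
    by_cases h : 0 < wtZ ξs d
    · simp only [ν, if_pos h]
      exact hsuppL b (natDegree_mem_support_of_nonzero hb)
    · simp only [ν, if_neg h]
      exact hsuppL b (natTrailingDegree_mem_support_of_nonzero hb)
  let ψ : ↥L' → ℝ := fun b => wt ξs (x b) - (ν b : ℝ) * wtZ ξs d
  obtain ⟨a, haF, hamin⟩ := Finset.exists_min_image (Finset.univ.filter fun b : ↥L' => lam b ≠ 0) ψ
    ⟨b₀, Finset.mem_filter.mpr ⟨Finset.mem_univ _, hb₀⟩⟩
  have ha0 : lam a ≠ 0 := (Finset.mem_filter.mp haF).2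
  obtain ⟨ξa, hξa, S, k, hrec, hSa⟩ := hwit a a.2
  have hcell : cellZ (tfamG x d J) ξs = cellZ (tfamG x d J) ξa := hξs.trans hξa.symm
  obtain ⟨hsp, hsn, hsz⟩ := sign_transferG x d J hcell
  have hνs : ∀ (b : ↥L'), ∀ s ∈ (lam b).support, 0 ≤ ((ν b : ℝ) - s) * wtZ ξa d := by
    intro b s hs
    rcases lt_trichotomy 0 (wtZ ξs d) with hc | hc | hc
    · have hν : ν b = (lam b).natDegree := by simp only [ν, if_pos hc]
      have hle : s ≤ ν b := hν ▸ le_natDegree_of_mem_supp s hs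
      exact mul_nonneg (sub_nonneg.mpr (by exact_mod_cast hle)) (hsp hc).le
    · rw [hsz hc.symm, mul_zero]
    · have hν : ν b = (lam b).natTrailingDegree := by simp only [ν, if_neg (not_lt.mpr hc.le)]
      have hle : ν b ≤ s := hν ▸ natTrailingDegree_le_of_ne_zero (mem_support_iff.mp hs)
      exact mul_nonneg_of_nonpos_of_nonpos (sub_nonpos.mpr (by exact_mod_cast hle)) (hsn hc).le
  let Q : Fin n → ℂ[X] := fun b => if h : b ∈ L' then (if (⟨b, h⟩ : ↥L') = a then 0 else - lam ⟨b, h⟩) else 0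
  have hQsum : ∀ g : Fin n → ℂ[X], (∑ b : ↥L', lam b * g b = 0) → ∑ b, Q b * g b = lam a * g a := by
    intro g hg
    have h1 : ∑ b, Q b * g b = ∑ b ∈ L', Q b * g b := by
      refine (Finset.sum_subset (Finset.subset_univ L') fun b _ hb => ?_).symm
      simp only [Q, dif_neg hb, zero_mul]
    have h2 : ∑ b ∈ L', Q b * g b = ∑ b : ↥L', Q b * g b := (Finset.sum_coe_sort L' _).symm
    have h3 : ∀ b : ↥L', Q b * g b = if b = a then 0 else (-(lam b * g b)) := by
      intro b
      show (if h : (b : Fin n) ∈ L' then (if (⟨b, h⟩ : ↥L') = a then 0 else - lam ⟨b, h⟩) else 0) * g b = _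
      rw [dif_pos b.property]
      simp only [Subtype.coe_eta]
      split_ifs <;> ring
    rw [h1, h2, Finset.sum_congr rfl fun b _ => h3 b, sum_ite_zero_else, Finset.sum_neg_distrib, hg]
    ring
  have hs0 : (lam a).coeff (ν a) ≠ 0 := by
    by_cases hc : 0 < wtZ ξs d
    · have hν : ν a = (lam a).natDegree := by simp only [ν, if_pos hc]
      rw [hν]
      exact leadingCoeff_ne_zero.mpr ha0
    · have hν : ν a = (lam a).natTrailingDegree := by simp only [ν, if_neg hc]
      rw [hν]
      exact fun h => ha0 (trailingCoeff_eq_zero.mp h)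
  have hQa : Q a = 0 := by
    show (if h : (a : Fin n) ∈ L' then (if (⟨a, h⟩ : ↥L') = a then 0 else - lam ⟨a, h⟩) else 0) = 0
    rw [dif_pos a.property]
    simp only [Subtype.coe_eta, if_true]
  have hrel : ∀ j, lam a * γ j a = ∑ b, Q b * γ j b := fun j =>
    (hQsum (fun b => γ j b) (hrelS (Sum.inl j))).symm
  have hrel' : ∀ j, lam a * γ' j a = ∑ b, Q b * γ' j b := fun j =>
    (hQsum (fun b => γ' j b) (hrelS (Sum.inr j))).symm
  have hQ : ∀ b, ∀ s ∈ (Q b).support, 0 ≤ wt ξa (x b) - wt ξa (x a) + ((ν a : ℝ) - s) * wtZ ξa d := by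
    intro b s hs
    by_cases hb : b ∈ L'
    · by_cases hba : (⟨b, hb⟩ : ↥L') = a
      · exfalso
        simp only [Q, dif_pos hb, if_pos hba, support_zero, Finset.notMem_empty] at hs
      · have hQb : Q b = - lam ⟨b, hb⟩ := by simp only [Q, dif_pos hb, if_neg hba]
        rw [hQb, support_neg] at hs
        have hlb : lam ⟨b, hb⟩ ≠ 0 := by
          intro h0
          rw [h0, support_zero] at hs
          exact Finset.notMem_empty _ hs
        have hmin := hamin ⟨b, hb⟩ (Finset.mem_filter.mpr ⟨Finset.mem_univ _, hlb⟩)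
        have hmin' : wt ξs (x a) - (ν a : ℝ) * wtZ ξs d ≤ wt ξs (x b) - (ν ⟨b, hb⟩ : ℝ) * wtZ ξs d := hmin
        have hj : ((ν a : ℕ) : ℤ) - (ν ⟨b, hb⟩ : ℕ) ∈ J := hJ _ (hνΛ a ha0) _ (hνΛ _ hlb)
        have hcast : ((((ν a : ℕ) : ℤ) - (ν ⟨b, hb⟩ : ℕ) : ℤ) : ℝ) = (ν a : ℝ) - ν ⟨b, hb⟩ := by push_cast; ring
        have h1 : 0 ≤ wtZ ξs (tfamG x d J (Sum.inr ((b, (a : Fin n)), ⟨_, hj⟩))) := by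
          rw [wtZ_tfamG_inr, hcast]
          have e3 : ((ν a : ℝ) - ν ⟨b, hb⟩) * wtZ ξs d = (ν a : ℝ) * wtZ ξs d - (ν ⟨b, hb⟩ : ℝ) * wtZ ξs d := by ring
          linarith
        have h2 := (nonneg_wtZ_iff_of_cellZ_eq (tfamG x d J) hcell _).mp h1
        rw [wtZ_tfamG_inr, hcast] at h2
        have h3 := hνs ⟨b, hb⟩ s hs
        have hsplit : ((ν a : ℝ) - s) * wtZ ξa d =
            ((ν a : ℝ) - ν ⟨b, hb⟩) * wtZ ξa d + ((ν ⟨b, hb⟩ : ℝ) - s) * wtZ ξa d := by ring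
        rw [hsplit]
        linarith
    · exfalso
      simp only [Q, dif_neg hb, support_zero, Finset.notMem_empty] at hs
  exact towerRecordLemma γ γ' x d m' ξa S k hrec a hSa (lam a) Q (ν a) hs0 hQa hrel hrel' (hνs a) hQ

/-- **THE SPARSE RECORD COUNT**: `#records ≤ 64 (n²|J| + 3)(m+1)2^{3m}` for any exchange set. -/
theorem towerRecordCountG (m n D : ℕ) (γ γ' : Fin m → Fin n → ℂ[X]) (hγD : DegLe γ D) (hγ'D : DegLe γ' D)
    (E Λ : Finset ℕ) (hγ : ∀ j i, (γ j i).support ⊆ E) (hγ' : ∀ j i, (γ' j i).support ⊆ E)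
    (hΛ : 2 * m * (Λ + E).card < (2 * m + 1) * Λ.card) (J : Finset ℤ) (hJ : ∀ u ∈ Λ, ∀ v ∈ Λ, ((u : ℤ) - v) ∈ J)
    (x : Fin n → Expo) (d : Fin 2 → ℤ) :
    ((shallowPairsT n m D).filter fun p => ∃ ξ : Fin 2 → ℝ, IsRecordT γ γ' x d m ξ p).card
      ≤ 32 * (2 + n * n * J.card + 1) * (2 * ((m + 1) * 2 ^ (2 * m + m))) := by
  calc _ ≤ ((cellSetZ (tfamG x d J)).biUnion fun κ =>
            candidatesT γ γ' D m (cellLettersG γ γ' x d J m κ)).card := Finset.card_le_card ?_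
    _ ≤ ∑ κ ∈ cellSetZ (tfamG x d J), (candidatesT γ γ' D m (cellLettersG γ γ' x d J m κ)).card :=
        Finset.card_biUnion_le
    _ ≤ ∑ _κ ∈ cellSetZ (tfamG x d J), 2 * ((m + 1) * 2 ^ (2 * m + m)) :=
        Finset.sum_le_sum fun κ _ => card_candidatesT_le γ γ' D m (2 * m) _
          (card_cellLettersG_le γ γ' E Λ hγ hγ' hΛ J hJ x d m κ)
    _ = (cellSetZ (tfamG x d J)).card * (2 * ((m + 1) * 2 ^ (2 * m + m))) := by
        rw [Finset.sum_const, smul_eq_mul]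
    _ ≤ 32 * (Fintype.card (TIdxG n J) + 1) * (2 * ((m + 1) * 2 ^ (2 * m + m))) :=
        Nat.mul_le_mul_right _ (card_cellSetZ_le _)
    _ = 32 * (2 + n * n * J.card + 1) * (2 * ((m + 1) * 2 ^ (2 * m + m))) := by rw [card_TIdxG]
  rintro ⟨S, k⟩ hp
  rw [Finset.mem_filter] at hp
  obtain ⟨-, ξ, hrec⟩ := hp
  rw [Finset.mem_biUnion]
  refine ⟨cellZ (tfamG x d J) ξ, cellZ_mem_cellSetZ _ ξ, ?_⟩
  have hlive := hrec.1
  simp only [liveT, Set.mem_setOf_eq] at hlive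
  obtain ⟨hsize, -⟩ := hlive
  have hS : S ∈ msets (cellLettersG γ γ' x d J m (cellZ (tfamG x d J) ξ)) m :=
    mem_msets hsize fun a ha => by
      simp only [cellLettersG, Finset.mem_filter, Finset.mem_univ, true_and]
      exact ⟨ξ, rfl, S, k, hrec, Nat.pos_of_ne_zero ha⟩
  rcases record_k γ γ' D hγD hγ'D x d m ξ S k hrec with h | h
  · exact Finset.mem_union_left _ (Finset.mem_image.mpr ⟨S, hS, by rw [h]⟩)
  · exact Finset.mem_union_right _ (Finset.mem_image.mpr ⟨S, hS, by rw [h]⟩)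

/-- Levels in `{0,1,H}` ⇒ degree `≤ H+1`. [folklore] -/
theorem degLe_of_levelsIn {γ : Fin m → Fin n → ℂ[X]} {H : ℕ} (h : LevelsIn γ {0, 1, H}) : DegLe γ (H + 1) := by
  intro j i
  by_cases h0 : γ j i = 0
  · rw [h0, natDegree_zero]
    exact Nat.zero_le _
  · have hmem := h j i (natDegree_mem_support_of_nonzero h0)
    simp only [Finset.mem_insert, Finset.mem_singleton] at hmem
    omega

/-- The exchange progression `{a + bH : a, b ≤ C}` and its arithmetic. -/
def gap (H C : ℕ) : Finset ℕ := (Finset.range (C + 1) ×ˢ Finset.range (C + 1)).image fun ab => ab.1 + ab.2 * H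

/-- The difference index set `{a + bH : |a|,|b| ≤ C}` of the three-level exchange set. [folklore] -/
def gapJ (H C : ℕ) : Finset ℤ :=
  (Finset.Icc (-(C : ℤ)) C ×ˢ Finset.Icc (-(C : ℤ)) C).image fun ab => ab.1 + ab.2 * (H : ℤ)

/-- `|gap H C| = (C+1)²` for `C < H`. [folklore] -/
theorem card_gap (H C : ℕ) (hH : C < H) : (gap H C).card = (C + 1) * (C + 1) := by
  rw [gap, Finset.card_image_of_injOn, Finset.card_product, Finset.card_range]
  rintro ⟨a, b⟩ hab ⟨a', b'⟩ hab' (h : a + b * H = a' + b' * H)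
  simp only [Finset.coe_product, Set.mem_prod, Finset.mem_coe, Finset.mem_range] at hab hab'
  have ha : a = a' := by
    have h1 := congrArg (· % H) h
    simp only [Nat.add_mul_mod_self_right, Nat.mod_eq_of_lt (show a < H by omega),
      Nat.mod_eq_of_lt (show a' < H by omega)] at h1
    exact h1
  subst ha
  have hb : b * H = b' * H := by omega
  have := Nat.eq_of_mul_eq_mul_right (by omega) hb
  subst this
  rfl

/-- `|gap H C + {0,1,H}| ≤ (C+2)²`. [folklore] -/
theorem card_gap_add_le (H C : ℕ) : (gap H C + ({0, 1, H} : Finset ℕ)).card ≤ (C + 2) * (C + 2) := by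
  have hsub : gap H C + ({0, 1, H} : Finset ℕ) ⊆
      (Finset.range (C + 2) ×ˢ Finset.range (C + 2)).image fun ab => ab.1 + ab.2 * H := by
    intro u hu
    rw [Finset.mem_add] at hu
    obtain ⟨y, hy, z, hz, rfl⟩ := hu
    rw [gap, Finset.mem_image] at hy
    obtain ⟨⟨a, b⟩, hab, rfl⟩ := hy
    simp only [Finset.mem_product, Finset.mem_range] at hab
    simp only [Finset.mem_insert, Finset.mem_singleton] at hz
    rw [Finset.mem_image]
    rcases hz with rfl | rfl | rfl
    · exact ⟨(a, b), by simp only [Finset.mem_product, Finset.mem_range]; omega, by ring⟩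
    · exact ⟨(a + 1, b), by simp only [Finset.mem_product, Finset.mem_range]; omega, by ring⟩
    · exact ⟨(a, b + 1), by simp only [Finset.mem_product, Finset.mem_range]; omega, by ring⟩
  refine (Finset.card_le_card hsub).trans (Finset.card_image_le.trans ?_)
  rw [Finset.card_product, Finset.card_range]

/-- `|gapJ H C| ≤ (2C+1)²`. [folklore] -/
theorem card_gapJ_le (H C : ℕ) : (gapJ H C).card ≤ (2 * C + 1) * (2 * C + 1) := by
  have hI : (Finset.Icc (-(C : ℤ)) C).card = 2 * C + 1 := by
    have h := Int.card_Icc_of_le (a := -(C : ℤ)) (b := C) (by omega)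
    omega
  refine Finset.card_image_le.trans ?_
  rw [Finset.card_product, hI]

/-- `gap H C − gap H C ⊆ gapJ H C`. [folklore] -/
theorem sub_mem_gapJ (H C : ℕ) {u v : ℕ} (hu : u ∈ gap H C) (hv : v ∈ gap H C) : ((u : ℤ) - v) ∈ gapJ H C := by
  rw [gap, Finset.mem_image] at hu hv
  obtain ⟨⟨a, b⟩, hab, rfl⟩ := hu
  obtain ⟨⟨a', b'⟩, hab', rfl⟩ := hv
  simp only [Finset.mem_product, Finset.mem_range] at hab hab'
  rw [gapJ, Finset.mem_image]
  refine ⟨((a : ℤ) - a', (b : ℤ) - b'), ?_, by push_cast; ring⟩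
  simp only [Finset.mem_product, Finset.mem_Icc]
  omega

/-- Arithmetic: the three-level count is `≤ 2^{23 m}(t+2)²` for `n ≤ 2mt`. [folklore] -/
theorem arith_sparse (m n t : ℕ) (hm : 1 ≤ m) (hn : n ≤ 2 * m * t) :
    32 * (2 + n * n * ((2 * (4 * m + 1) + 1) * (2 * (4 * m + 1) + 1)) + 1) * (2 * ((m + 1) * 2 ^ (2 * m + m)))
      ≤ 2 ^ (23 * m) * (t + 2) ^ 2 := by
  obtain ⟨X, hX⟩ : ∃ X : ℕ, X = 2 ^ m := ⟨_, rfl⟩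
  have hmX : m + 1 ≤ X := hX ▸ Nat.lt_two_pow_self
  have hX2 : 2 ≤ X := by
    rw [hX]
    calc (2 : ℕ) = 2 ^ 1 := (pow_one 2).symm
      _ ≤ 2 ^ m := Nat.pow_le_pow_right (by norm_num) hm
  have h3 : 2 ^ (2 * m + m) = X ^ 3 := by
    rw [hX, ← pow_mul]
    ring_nf
  have h23 : 2 ^ (23 * m) = X ^ 23 := by rw [hX, ← pow_mul, mul_comm]
  rw [h3, h23]
  have hn' : n ≤ 2 * X * (t + 2) := by
    calc n ≤ 2 * m * t := hn
      _ ≤ 2 * X * (t + 2) := Nat.mul_le_mul (Nat.mul_le_mul_left 2 (by omega)) (by omega)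
  have hF : 2 * (4 * m + 1) + 1 ≤ 10 * X := by omega
  have hA : n * n * ((2 * (4 * m + 1) + 1) * (2 * (4 * m + 1) + 1)) ≤ 400 * (X ^ 4 * (t + 2) ^ 2) :=
    calc n * n * ((2 * (4 * m + 1) + 1) * (2 * (4 * m + 1) + 1))
        ≤ (2 * X * (t + 2)) * (2 * X * (t + 2)) * ((10 * X) * (10 * X)) :=
          Nat.mul_le_mul (Nat.mul_le_mul hn' hn') (Nat.mul_le_mul hF hF)
      _ = 400 * (X ^ 4 * (t + 2) ^ 2) := by ring
  have hP : 1 ≤ X ^ 4 * (t + 2) ^ 2 := Nat.one_le_iff_ne_zero.mpr (by positivity)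
  have hB : 2 + n * n * ((2 * (4 * m + 1) + 1) * (2 * (4 * m + 1) + 1)) + 1 ≤ 403 * (X ^ 4 * (t + 2) ^ 2) := by omega
  have hC : 2 * ((m + 1) * X ^ 3) ≤ 2 * (X * X ^ 3) := Nat.mul_le_mul_left 2 (Nat.mul_le_mul_right _ hmX)
  have hK : 25792 ≤ X ^ 15 :=
    calc 25792 ≤ 2 ^ 15 := by norm_num
      _ ≤ X ^ 15 := Nat.pow_le_pow_left hX2 15
  calc 32 * (2 + n * n * ((2 * (4 * m + 1) + 1) * (2 * (4 * m + 1) + 1)) + 1) * (2 * ((m + 1) * X ^ 3))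
      ≤ 32 * (403 * (X ^ 4 * (t + 2) ^ 2)) * (2 * (X * X ^ 3)) := Nat.mul_le_mul (Nat.mul_le_mul_left _ hB) hC
    _ = 25792 * (X ^ 8 * (t + 2) ^ 2) := by ring
    _ ≤ X ^ 15 * (X ^ 8 * (t + 2) ^ 2) := Nat.mul_le_mul_right _ hK
    _ = X ^ 23 * (t + 2) ^ 2 := by ring

/-- **THE THREE-LEVEL RECORD LAW, PROVED** — `(a, b) = (23, 2)`, uniformly in the height `H`. -/
theorem threeLevelRecordLaw_holds : ThreeLevelRecordLaw := by
  refine ⟨23, 2, fun m n t H γ γ' x d hγ hγ' hn => ?_⟩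
  rcases Nat.eq_zero_or_pos m with rfl | hm
  · have h0 : ((shallowPairsT n 0 (H + 1)).filter fun p => ∃ ξ : Fin 2 → ℝ, IsRecordT γ γ' x d 0 ξ p).card = 0 := by
      rw [Finset.card_eq_zero, Finset.filter_eq_empty_iff]
      rintro p - ⟨ξ, hrec⟩
      have h := hrec.1
      simp only [liveT, Set.mem_setOf_eq, layerT, momentPolyT] at h
      exact h.2 (by simp)
    rw [h0]
    exact Nat.zero_le _
  have hD := degLe_of_levelsIn hγ
  have hD' := degLe_of_levelsIn hγ'
  have hX1 : m + 1 ≤ 2 ^ m := Nat.lt_two_pow_self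
  by_cases hH : H ≤ 4 * m + 2
  · -- low towers: the dense law with `D = H + 1 ≤ 4m + 3`
    refine ((towerRecordCount m n (H + 1) γ γ' hD hD' x d).trans (arith_tower m n t (H + 1) hm hn)).trans ?_
    have h5 : H + 1 + 1 ≤ 2 ^ (5 * m) := by
      calc H + 1 + 1 ≤ 4 * (m + 1) := by omega
        _ ≤ 2 ^ 2 * 2 ^ m := by rw [show (2:ℕ) ^ 2 = 4 by norm_num]; exact Nat.mul_le_mul_left 4 hX1
        _ = 2 ^ (2 + m) := (pow_add 2 2 m).symm
        _ ≤ 2 ^ (5 * m) := Nat.pow_le_pow_right (by norm_num) (by omega)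
    calc 2 ^ (18 * m) * (t + 2) ^ 2 * (H + 1 + 1) ≤ 2 ^ (18 * m) * (t + 2) ^ 2 * 2 ^ (5 * m) :=
          Nat.mul_le_mul_left _ h5
      _ = 2 ^ (23 * m) * (t + 2) ^ 2 := by rw [mul_comm (2 ^ (18 * m) * (t + 2) ^ 2), ← mul_assoc, ← pow_add]; ring_nf
  · -- tall towers: the exchange progression `{a + bH : a, b ≤ 4m+1}`
    rw [not_le] at hH
    set C := 4 * m + 1 with hC
    have hΛ : 2 * m * (gap H C + ({0, 1, H} : Finset ℕ)).card < (2 * m + 1) * (gap H C).card := by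
      rw [card_gap H C (by omega)]
      refine lt_of_le_of_lt (Nat.mul_le_mul_left _ (card_gap_add_le H C)) ?_
      have : (2 * m + 1) * ((C + 1) * (C + 1)) = 2 * m * ((C + 2) * (C + 2)) + (6 * m + 4) := by
        rw [hC]; ring
      omega
    refine (towerRecordCountG m n (H + 1) γ γ' hD hD' {0, 1, H} (gap H C) hγ hγ' hΛ (gapJ H C)
      (fun u hu v hv => sub_mem_gapJ H C hu hv) x d).trans ?_
    refine le_trans ?_ (arith_sparse m n t hm hn)
    have hJ := card_gapJ_le H C
    rw [hC] at hJ
    have : n * n * (gapJ H (4 * m + 1)).card ≤ n * n * ((2 * (4 * m + 1) + 1) * (2 * (4 * m + 1) + 1)) :=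
      Nat.mul_le_mul_left _ hJ
    have : 2 + n * n * (gapJ H C).card + 1 ≤ 2 + n * n * ((2 * (4 * m + 1) + 1) * (2 * (4 * m + 1) + 1)) + 1 := by
      rw [hC]; omega
    exact Nat.mul_le_mul (Nat.mul_le_mul_left _ this) le_rfl

end SparseFile

end Summit.ValiantsHypothesis.ValiantsHypothesis.Theorems.NewtonUnitEquations.TwoProducts.TowerRecord

end
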